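import Literature.AlgebraicGeometry.ModuliOfAbelianVarieties.SymplecticLiftableOfMarkedFibre         -- ★ [L1] `isSymplecticLiftable_of_markedComplexFibre`
import Literature.AlgebraicGeometry.ModuliOfAbelianVarieties.SiegelAdelicMarkingCoverPairingReading  -- ★ [L2-pair] `SiegelAdelicMarking.pairingReading_comp_of_similitude` (+ ★ [L2-level])
import Literature.AlgebraicGeometry.Motives.AbelianVarietyWeilPairingAlongIsogeny                   -- ★ `AbelianVariety.weilPairingLevel_map_map_eq_of_mixedLevel`
import Literature.AlgebraicGeometry.Motives.AbelianVarietyFundamentalGroup                          -- ★ `AbelianVariety.pow_surjective`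
import HarnessLib

/-!
# The level structure `φ′ = c ∘ φ` of a COVER `c : B → B′` is symplectic-liftable, from ONE marked complex fibre of `B` read through `r′`
# and the quotient marking read through `r` ([Lan 2013] Lemma 1.3.6.5, Cor. 1.3.6.7; [Mumford 1970] §20, §23; [Milne 2005] Thm. 6.11)

Topic `AlgebraicGeometry/ModuliOfAbelianVarieties`; namespace `Literature.AlgebraicGeometry.ModuliOfAbelianVarieties`.  THEOREMS ONLY (no definition, no named
fact, no instance, no notation, no `sorry`; net debt 0).  Cell `hodgecm-mathlib`, FLOOR 0, P6 «MOD programme» (crux hLiu418 = stmt-HodgeConjecture-24832,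
`--supports`), X-LEAF sheet line, organ (S1b)(m4) «the twisted level structure `η′` is symplectic-liftable for the exact twisted polarisation `λ′`», road (β)
(A-p01 (g28) 2026-09-02T06:25:25Z) — the ONE-CALL ZIP of its layers [L1] ★ `SymplecticLiftableOfMarkedFibre`, [L2-level] ★ `SiegelAdelicMarkingCoverLevelReading`,
[L2-pair] ★ `SiegelAdelicMarkingCoverPairingReading`, [L3] the divisor clause (★ `SerreTwistExactPolarizationAmple.weilDiv_pullback_serreTranslate_linEquiv_nsmul_of_isExactTwistPol`,
LA7-p01 (g3)), for the (S8) closer and the `hsymp` binder of ★ `SerreTwistModuliTuple.exists_serreTwist_moduliTuple`.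

* §1 `AbelianSchemeOver.mixedWeilClause_of_weilDiv_linEquiv` — over `ℂ`, the MIXED-LEVEL WEIL CLAUSE «`ē^{Θ′}_M(c a, c b) = ē^{Θ}_{νM}(a, b)`» (the `hW` binder of ★
  `pairingReading_comp_of_similitude`) from the DIVISOR CLAUSE `D_Q(c_s^*Θ′) ∼ ν·D_Q(Θ)` and dominance of `c_s` (★ `weilPairingLevel_map_map_eq_of_mixedLevel`, divisibility
  of complex points ★ `pow_surjective`, dominance of `[n]` ★ `isDominant_toSchemeHom_zsmul_of_ne_zero`);
* §2 **`AbelianSchemeOver.LevelStructure.isSymplecticLiftable_of_markedComplexFibre_comp`** — for `c : B → B′` over a preconnected reduced locally Noetherian base on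
  which positive integers are invertible, `φ′.σ i = φ.σ i ≫ c`, a polarisation `pol′` of `B′` with a witness `Θ′` at a complex point `s₀`, a divisor `Θ` on `B_{s₀}` with
  `D_Q(c_{s₀}^*Θ′) ∼ ν·D_Q(Θ)`, a marking `m` of `B_{s₀}` by `[J, r′]` through which `(φ, Θ)` are read (`hlevel`, `hpair`), the quotient marking `m′` of `B′_{s₀}` by
  `[J′, r]` (`u′ = c ∘ u`) with `r⁻¹r′ ≡ 1 (mod N)`, `ν·r′⁻¹r` integral and multiplier `ν⁻¹ε`, `ε ∈ ẑ^×`: **`φ′` is symplectic-liftable of type `δ` for `pol′`**.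

## References
* [Lan2013PELCompactifications] K.-W. Lan, *Arithmetic compactifications of PEL-type Shimura varieties* (2013), §1.3.6 Lemma 1.3.6.5 (p. 81), Lemma 1.3.6.6 and
  Cor. 1.3.6.7 (pp. 81–82).
* [MumfordAV1970] D. Mumford, *Abelian Varieties* (1970), §20 (pp. 184–186), §23 Thm. 2 (p. 231).
* [Milne2005ShimuraVarieties] J. S. Milne, *Introduction to Shimura varieties* (2005), §6 Thm. 6.11 p. 74 and p. 75, §12 (63) p. 116.
* [Deligne1971TravauxShimura] P. Deligne, *Travaux de Shimura* (1971), 4.12 (b) p. 149, 4.16 p. 150.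
-/

set_option autoImplicit false

noncomputable section

open Matrix CategoryTheory AlgebraicGeometry NumberField IsDedekindDomain
open Literature.AlgebraicGeometry.Motives (AbelianVariety AlgPoints CartierDivisor)
open Literature.AlgebraicGeometry.AbelianSchemes (AbelianSchemeOver)
open Literature.NumberTheory.Adeles (latticeOfGL)

namespace Literature.AlgebraicGeometry.ModuliOfAbelianVarieties

variable {g : ℕ} {δ : Fin g → ℕ}

/-! ## §1 The mixed-level Weil clause over `ℂ` from the divisor clause -/

/-- **(W′) OVER `ℂ` FROM THE DIVISOR CLAUSE**: for a homomorphism `c : B → B′` of abelian schemes whose fibre `c_s` at a complex point is dominant, and divisors `Θ`, `Θ′`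
with `D_Q(c_s^*Θ′) ∼ ν·D_Q(Θ)` for all `Q ∈ B_s(ℂ)` (`ν ≠ 0`): `ē^{Θ′}_M(P, Q) = ē^{Θ}_{νM}(a, b)` whenever `P = c a`, `Q = c b`, `a, b ∈ B_s[νM]`, `P, Q ∈ B′_s[M]` — the `hW`
binder of ★ `SiegelAdelicMarking.pairingReading_comp_of_similitude` (★ `weilPairingLevel_map_map_eq_of_mixedLevel`; complex points are divisible, ★ `pow_surjective`).
[cite: MumfordAV1970, §20 (properties (1)–(3) of e_n, pp. 184–186) and §23 (Thm. 2, p. 231)] -/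
theorem _root_.Literature.AlgebraicGeometry.AbelianSchemes.AbelianSchemeOver.mixedWeilClause_of_weilDiv_linEquiv
    {S : Scheme.{0}} {B B' : AbelianSchemeOver S} {s : Spec (.of ℂ) ⟶ S} (c : B.X ⟶ B'.X) [IsMonHom c]
    [IsDominant (AbelianVariety.Hom.toSchemeHom (AbelianSchemeOver.fibreHom c s))] {ν : ℕ} (hν : ν ≠ 0)
    (Θ : CartierDivisor (B.fibre s).toAbelianVariety.X.left) (Θ' : CartierDivisor (B'.fibre s).toAbelianVariety.X.left)
    (hdiv : ∀ Q : (B.fibre s).toAbelianVariety.Points ℂ,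
      ((B.fibre s).toAbelianVariety.weilDiv (Θ'.pullback (AbelianVariety.Hom.toSchemeHom (AbelianSchemeOver.fibreHom c s))) Q).LinEquiv
        (ν • (B.fibre s).toAbelianVariety.weilDiv Θ Q))
    (N : ℕ) :
    ∀ ⦃M : ℕ⦄, N ∣ M → ∀ (hMΩ : (M : ℂ) ≠ 0) (hνMΩ : ((ν * M : ℕ) : ℂ) ≠ 0)
      (a b : (B.fibre s).toAbelianVariety.torsionPoints ℂ ((ν * M : ℕ) : ℤ))
      (P Q : (B'.fibre s).toAbelianVariety.torsionPoints ℂ (M : ℤ)),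
      (P : (B'.fibre s).toAbelianVariety.Points ℂ) = AlgPoints.map (AbelianSchemeOver.fibreHom c s).hom.hom.hom a.1 →
      (Q : (B'.fibre s).toAbelianVariety.Points ℂ) = AlgPoints.map (AbelianSchemeOver.fibreHom c s).hom.hom.hom b.1 →
      haveI := AbelianVariety.isDominant_toSchemeHom_zsmul_of_ne_zero (B'.fibre s).toAbelianVariety hMΩ
      haveI := AbelianVariety.isDominant_toSchemeHom_zsmul_of_ne_zero (B.fibre s).toAbelianVariety hνMΩ
      (B'.fibre s).toAbelianVariety.weilPairingLevel Θ' P Q =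
        (B.fibre s).toAbelianVariety.weilPairingLevel (N := ν * M) Θ a b := by
  intro M _ hMΩ hνMΩ a b P Q hP hQ
  have hνM : ν * M ≠ 0 := by rintro h; exact hνMΩ (by rw [h, Nat.cast_zero])
  have hνΩ : (ν : ℂ) ≠ 0 := Nat.cast_ne_zero.2 hν
  haveI := AbelianVariety.isDominant_toSchemeHom_zsmul_of_ne_zero (B'.fibre s).toAbelianVariety hMΩ
  haveI := AbelianVariety.isDominant_toSchemeHom_zsmul_of_ne_zero (B'.fibre s).toAbelianVariety hνΩ
  haveI := AbelianVariety.isDominant_toSchemeHom_zsmul_of_ne_zero (B.fibre s).toAbelianVariety hνMΩ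
  haveI := AbelianVariety.isDominant_toSchemeHom_zsmul_of_ne_zero (B'.fibre s).toAbelianVariety hνMΩ
  exact AbelianVariety.weilPairingLevel_map_map_eq_of_mixedLevel (AbelianSchemeOver.fibreHom c s) Θ Θ' hdiv
    (AbelianVariety.pow_surjective _ ν hν) (AbelianVariety.pow_surjective _ (ν * M) hνM) a b P Q hP hQ

/-! ## §2 The zip: `φ′ = c ∘ φ` is symplectic-liftable from one marked complex fibre and the quotient marking -/

/-- **(S1b)(m4) IN MARKED-FIBRE CURRENCY — `φ′` IS SYMPLECTIC-LIFTABLE FOR `pol′`.**  Base `S` preconnected, reduced, locally Noetherian, every positive integer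
invertible on `S`; `c : B → B′` a homomorphism with `φ′.σ i = φ.σ i ≫ c` (level `N ≠ 0`); `pol′` a polarisation of `B′` (relative dimension `g`) with a witness `Θ′` of
`λ̄′` at the complex point `s₀`; `Θ` a divisor on `B_{s₀}` with the divisor clause `D_Q(c_{s₀}^*Θ′) ∼ ν·D_Q(Θ)` and `c_{s₀}` dominant; `m` a marking of `B_{s₀}` by
`[J, r′]` reading `φ` at the classes `eᵢ∕N` (`hlevel`) and the Weil pairing of `Θ` in `δ`-normal form for compatible primitive roots `ζ` (`hpair`); `m′` a marking of
`B′_{s₀}` by `[J′, r]` with `u′ = c_{s₀} ∘ u`, where `r⁻¹r′ ≡ 1 (mod N·ẑ)`, `ν·r′⁻¹r ∈ M_{2g}(ẑ)` and `ᵗ(r′⁻¹r) E_δ (r′⁻¹r) = μ E_δ` with `ν μ = ε ∈ ẑ^×`.  THEN `φ′` is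
symplectic-liftable of type `δ` for `pol′` — ★ [L2-pair] + ★ [L2-level] feed ★ [L1]. [cite: Lan2013PELCompactifications, §1.3.6 Lemma 1.3.6.5 (p. 81), Lemma 1.3.6.6 and Cor. 1.3.6.7 (pp. 81–82)]
[cite: MumfordAV1970, §20 (properties (1)–(3) of e_n, pp. 184–186) and §23 (Thm. 2, p. 231)] [cite: Milne2005ShimuraVarieties, §6 Thm. 6.11 p. 74 and §12 (63) p. 116] -/
theorem _root_.Literature.AlgebraicGeometry.AbelianSchemes.AbelianSchemeOver.LevelStructure.isSymplecticLiftable_of_markedComplexFibre_comp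
    {J J' : C0pm δ} {r' r : gspFinAdelic δ}
    {S : Scheme.{0}} [PreconnectedSpace S] [IsLocallyNoetherian S] [IsReduced S] {B B' : AbelianSchemeOver S}
    (hg' : B'.IsOfRelDim g) (hQ : ∀ M : ℕ, M ≠ 0 → ∀ s : S, (M : S.residueField s) ≠ 0)
    {N : ℕ} (hN : N ≠ 0) (φ : B.LevelStructure g N) (φ' : B'.LevelStructure g N)
    (c : B.X ⟶ B'.X) [IsMonHom c] (hφ' : ∀ i, φ'.σ i = φ.σ i ≫ c)
    {D' : B'.DualPair} (pol' : B'.Polarization D') {s₀ : Spec (.of ℂ) ⟶ S}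
    [IsDominant (AbelianVariety.Hom.toSchemeHom (AbelianSchemeOver.fibreHom c s₀))]
    (Θ : CartierDivisor (B.fibre s₀).toAbelianVariety.X.left) (Θ' : CartierDivisor (B'.fibre s₀).toAbelianVariety.X.left)
    (hΘ' : B'.IsLambdaOfAt s₀ D' pol'.lam Θ') {ν : ℕ} (hν : ν ≠ 0)
    (hdiv : ∀ Q : (B.fibre s₀).toAbelianVariety.Points ℂ,
      ((B.fibre s₀).toAbelianVariety.weilDiv (Θ'.pullback (AbelianVariety.Hom.toSchemeHom (AbelianSchemeOver.fibreHom c s₀))) Q).LinEquiv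
        (ν • (B.fibre s₀).toAbelianVariety.weilDiv Θ Q))
    (m : SiegelAdelicMarking J r' (B.fibre s₀).toAbelianVariety) (m' : SiegelAdelicMarking J' r (B'.fibre s₀).toAbelianVariety)
    (hm' : ∀ v, m'.r v = AlgPoints.map (AbelianSchemeOver.fibreHom c s₀).hom.hom.hom (m.r v))
    (hT : ∀ i j, (ν : finAdeleQ) *
      (((r'⁻¹ * r : gspFinAdelic δ) : GL (Fin g ⊕ Fin g) finAdeleQ) : Matrix (Fin g ⊕ Fin g) (Fin g ⊕ Fin g) finAdeleQ) i j ∈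
        FiniteAdeleRing.integralAdeles (𝓞 ℚ) ℚ)
    {μ : finAdeleQˣ} (hμ : IsMultiplier (typeFormOver δ finAdeleQ) ((r'⁻¹ * r : gspFinAdelic δ) : GL (Fin g ⊕ Fin g) finAdeleQ) μ)
    (ε : (FiniteAdeleRing.integralAdeles (𝓞 ℚ) ℚ)ˣ)
    (hε : ((ε : FiniteAdeleRing.integralAdeles (𝓞 ℚ) ℚ) : finAdeleQ) = (ν : finAdeleQ) * (μ : finAdeleQ))
    (hk : ∀ i j, ∃ t ∈ FiniteAdeleRing.integralAdeles (𝓞 ℚ) ℚ,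
      ((((r⁻¹ * r' : gspFinAdelic δ) : GL (Fin g ⊕ Fin g) finAdeleQ) : Matrix (Fin g ⊕ Fin g) (Fin g ⊕ Fin g) finAdeleQ) - 1) i j =
        (N : finAdeleQ) * t)
    (ζ : ℕ → ℂ) (hζ : ∀ ⦃M : ℕ⦄, N ∣ M → M ≠ 0 → IsPrimitiveRoot (ζ M) M)
    (hζ_pow : ∀ ⦃M : ℕ⦄ (k : ℕ), N ∣ M → M ≠ 0 → k ≠ 0 → ζ (k * M) ^ k = ζ M)
    (hpair : ∀ ⦃M : ℕ⦄, N ∣ M → ∀ (hMΩ : (M : ℂ) ≠ 0) (x y : Fin g ⊕ Fin g → ZMod M)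
      (P Q : (B.fibre s₀).toAbelianVariety.torsionPoints ℂ (M : ℤ)),
      (∀ v, AdelicCongr ((r'⁻¹ : gspFinAdelic δ) : GL (Fin g ⊕ Fin g) finAdeleQ) 1 v
          (fun i => ((x i).val : ℚ) / M) → (P : (B.fibre s₀).toAbelianVariety.Points ℂ) = m.r v) →
      (∀ w, AdelicCongr ((r'⁻¹ : gspFinAdelic δ) : GL (Fin g ⊕ Fin g) finAdeleQ) 1 w
          (fun i => ((y i).val : ℚ) / M) → (Q : (B.fibre s₀).toAbelianVariety.Points ℂ) = m.r w) →
      haveI := AbelianVariety.isDominant_toSchemeHom_zsmul_of_ne_zero (B.fibre s₀).toAbelianVariety hMΩ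
      (B.fibre s₀).toAbelianVariety.weilPairingLevel Θ P Q = ζ M ^ (AbelianSchemeOver.typeFormMod δ M x y).val)
    (hlevel : ∀ i : Fin g ⊕ Fin g, ∃ v : Fin g ⊕ Fin g → ℚ,
      AdelicCongr ((r'⁻¹ : gspFinAdelic δ) : GL (Fin g ⊕ Fin g) finAdeleQ) 1 v
          (fun j => (((Pi.single i (1 : ZMod N) : Fin g ⊕ Fin g → ZMod N) j).val : ℚ) / N) ∧
        B.restrictPt s₀ (φ.σ i) = m.r v) :
    φ'.IsSymplecticLiftable pol' δ := by
  obtain ⟨ζ', hζ', hζ'_pow, hpair'⟩ := SiegelAdelicMarking.pairingReading_comp_of_similitude c m m' hm' hν hT hμ ε hε Θ Θ' ζ hζ hζ_pow hpair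
    (AbelianSchemeOver.mixedWeilClause_of_weilDiv_linEquiv c hν Θ Θ' hdiv N)
  exact isSymplecticLiftable_of_markedComplexFibre hg' hQ φ' hN pol' Θ' hΘ' m' ζ' hζ' hζ'_pow hpair'
    (SiegelAdelicMarking.levelReading_comp_of_congr c m m' hm' φ φ' hφ' hk hlevel)

end Literature.AlgebraicGeometry.ModuliOfAbelianVarieties

end
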